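import Literature.Probability.RandomPlanarGeometry.LocalMartingaleProofs
import Mathlib.Probability.Independence.Basic
import Mathlib.MeasureTheory.Constructions.Projective
import HarnessLib

/-!
# Two independent Brownian motions: the weak Markov property of the pair

Trunk T-PROBABILITY (Literature/Probability/Process). The driving noise of a Langevin chain with
two heat baths is a pair of independent standard Brownian motions. On the product
`WienerPair = (ℝ≥0 → ℝ) × (ℝ≥0 → ℝ)` of two canonical spaces with the product `wienerPair` of two
pre-Wiener measures, the two coordinates of `Literature.Probability.Process.brownian` (all paths continuous, `B 0 = 0`) are
independent Brownian motions, and this file packages the **simple (weak) Markov property of the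
pair at a deterministic time `s`**, in the form consumed by the construction of the transition
semigroup of an SDE with additive noise:

* `Literature.pairPath ω`, `Literature.pairShift s ω`, `Literature.pairPast s ω` — the pair of (continuous) paths,
  the pair of shifted paths `u ↦ B_{s+u} - B_s`, and the pair of paths restricted to `[0, s]`;
* `Literature.Probability.Process.indepFun_pairShift_pairPast` — the shifted pair is independent of the past pair
  (Mathlib's `IsPreBrownianReal.indepFun_shift` for each coordinate, combined across the two
  independent coordinates by `Literature.Probability.Process.indepFun_prodMap`);
* `Literature.Probability.Process.map_pairShift_eq_map_pairPath` — the shifted pair has the law of the pair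
  (`IsPreBrownianReal.shift` and uniqueness of the projective limit of the Brownian
  finite-dimensional laws, `IsPreBrownianReal.map_path_eq`), and
  `Literature.Probability.Process.map_pairPath_wienerPair` — the pair of continuous paths has law `wienerPair` itself.

General lemmas proved on the way: `Literature.Probability.Process.indepFun_prodMap` (independence is preserved under
pairing across a product of probability spaces) and `IsPreBrownianReal.map_path_eq` (two
pre-Brownian motions with measurable marginals have the same law on path space).

## References

* D. Revuz, M. Yor, *Continuous Martingales and Brownian Motion* (3rd ed., 1999), Ch. I §1
  (laws of processes are determined by finite-dimensional distributions) and Ch. III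
  (the simple Markov property of Brownian motion).
* O. Kallenberg, *Foundations of Modern Probability* (2nd ed., 2002), Lemma 3.10 (independence on
  product spaces), Thm 13.5 (Brownian motion; the shifted process `B_{s+·} - B_s` is again a
  Brownian motion independent of the past). [folklore]
-/

noncomputable section

open MeasureTheory ProbabilityTheory Filter Topology Set
open scoped NNReal ENNReal

namespace Literature.Probability.Process

/-! ### Independence across a product of probability spaces -/

/-- **Pairing independent pairs across a product space.** If `f ⟂ g` under `μ` and `f' ⟂ g'`
under `ν`, then `(f, f') ⟂ (g, g')` under `μ ⊗ ν` (as maps `Prod.map f f'`, `Prod.map g g'` on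
`Ω × Ω'`): check the product formula on the generating π-systems of measurable rectangles.
Kallenberg, *Foundations of Modern Probability* (2002), Lemma 3.10. [folklore] -/
theorem indepFun_prodMap {Ω Ω' α β γ δ : Type*} {mΩ : MeasurableSpace Ω}
    {mΩ' : MeasurableSpace Ω'} [MeasurableSpace α] [MeasurableSpace β] [MeasurableSpace γ]
    [MeasurableSpace δ] {μ : Measure Ω} {ν : Measure Ω'} [IsProbabilityMeasure μ]
    [IsProbabilityMeasure ν] {f : Ω → α} {g : Ω → β} {f' : Ω' → γ} {g' : Ω' → δ}
    (hfg : IndepFun f g μ) (hfg' : IndepFun f' g' ν) (hf : Measurable f) (hg : Measurable g)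
    (hf' : Measurable f') (hg' : Measurable g') :
    IndepFun (Prod.map f f') (Prod.map g g') (μ.prod ν) := by
  have hF : Measurable (Prod.map f f') := hf.prodMap hf'
  have hG : Measurable (Prod.map g g') := hg.prodMap hg'
  set pα : Set (Set (α × γ)) := image2 (· ×ˢ ·) {s | MeasurableSet s} {t | MeasurableSet t}
    with hpα
  set pβ : Set (Set (β × δ)) := image2 (· ×ˢ ·) {s | MeasurableSet s} {t | MeasurableSet t}
    with hpβ
  have hπα : IsPiSystem pα :=
    MeasurableSpace.isPiSystem_measurableSet.prod MeasurableSpace.isPiSystem_measurableSet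
  have hπβ : IsPiSystem pβ :=
    MeasurableSpace.isPiSystem_measurableSet.prod MeasurableSpace.isPiSystem_measurableSet
  have hgenα : MeasurableSpace.comap (Prod.map f f') Prod.instMeasurableSpace =
      MeasurableSpace.generateFrom {s | ∃ t ∈ pα, Prod.map f f' ⁻¹' t = s} := by
    rw [← generateFrom_prod, MeasurableSpace.comap_generateFrom]
    rfl
  have hgenβ : MeasurableSpace.comap (Prod.map g g') Prod.instMeasurableSpace =
      MeasurableSpace.generateFrom {s | ∃ t ∈ pβ, Prod.map g g' ⁻¹' t = s} := by
    rw [← generateFrom_prod, MeasurableSpace.comap_generateFrom]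
    rfl
  rw [IndepFun_iff_Indep]
  refine IndepSets.indep hF.comap_le hG.comap_le (hπα.comap _) (hπβ.comap _) hgenα hgenβ ?_
  rw [IndepSets_iff]
  rintro _ _ ⟨_, ⟨s, hs, t, ht, rfl⟩, rfl⟩ ⟨_, ⟨u, hu, v, hv, rfl⟩, rfl⟩
  simp only [mem_setOf_eq] at hs ht hu hv
  rw [Set.preimage_prod_map_prod, Set.preimage_prod_map_prod, Set.prod_inter_prod,
    Measure.prod_prod, Measure.prod_prod, Measure.prod_prod,
    hfg.measure_inter_preimage_eq_mul _ _ hs hu, hfg'.measure_inter_preimage_eq_mul _ _ ht hv]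
  ring

/-! ### Laws of pre-Brownian motions on path space -/

/-- The law on path space of a pre-Brownian motion with measurable marginals is a projective
limit of the Brownian finite-dimensional family. Dot-notation extension declared in Mathlib's
namespace `ProbabilityTheory.IsPreBrownianReal`. Revuz–Yor (1999), Ch. I §3. [folklore] -/
theorem _root_.ProbabilityTheory.IsPreBrownianReal.isProjectiveLimit_map_path {Ω : Type*} {mΩ : MeasurableSpace Ω}
    {P : Measure Ω} {X : ℝ≥0 → Ω → ℝ} (hX : IsPreBrownianReal X P) (hXm : ∀ t, Measurable (X t)) :
    IsProjectiveLimit (P.map fun ω t => X t ω) BrownianReal.projectiveFamily := by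
  intro I
  rw [Measure.map_map (Finset.measurable_restrict I) (measurable_pi_lambda _ hXm)]
  exact (hX.hasLaw I).map_eq

/-- **Two pre-Brownian motions with measurable marginals have the same law on path space**
(`ℝ≥0 → ℝ` with the product σ-algebra): both laws are projective limits of the Brownian
finite-dimensional family (`IsPreBrownianReal.isProjectiveLimit_map_path`), and projective limits
are unique (Mathlib `IsProjectiveLimit.unique`). Dot-notation extension declared in Mathlib's
namespace `ProbabilityTheory.IsPreBrownianReal`. Revuz–Yor, *Continuous Martingales and Brownian
Motion* (1999), Ch. I §1–§3. [folklore] -/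
theorem _root_.ProbabilityTheory.IsPreBrownianReal.map_path_eq {Ω Ω' : Type*} {mΩ : MeasurableSpace Ω}
    {mΩ' : MeasurableSpace Ω'} {P : Measure Ω} {P' : Measure Ω'} {X : ℝ≥0 → Ω → ℝ}
    {Y : ℝ≥0 → Ω' → ℝ} (hX : IsPreBrownianReal X P) (hY : IsPreBrownianReal Y P')
    (hXm : ∀ t, Measurable (X t)) (hYm : ∀ t, Measurable (Y t)) :
    P.map (fun ω t => X t ω) = P'.map (fun ω t => Y t ω) :=
  (hX.isProjectiveLimit_map_path hXm).unique (hY.isProjectiveLimit_map_path hYm)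

/-! ### The pair of canonical Brownian motions -/

/-- The product of two canonical path spaces. [folklore] -/
abbrev WienerPair : Type := (ℝ≥0 → ℝ) × (ℝ≥0 → ℝ)

/-- The product of two pre-Wiener measures: the law of a pair of independent standard Brownian
motions (in raw-path coordinates). Kallenberg, *Foundations* (2002), Thm 13.5 and Lemma 3.10.
[folklore] -/
def wienerPair : Measure WienerPair :=
  preWienerMeasure.prod preWienerMeasure

/-- `wienerPair` is a probability measure. [folklore] -/
instance isProbabilityMeasure_wienerPair : IsProbabilityMeasure wienerPair := by
  haveI := RandomPlanarGeometry.isProbabilityMeasure_preWienerMeasure'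
  unfold wienerPair
  infer_instance

/-- The **pair of continuous Brownian paths** `(B_·(ω₁), B_·(ω₂))` of a sample `ω = (ω₁, ω₂)`
(the continuous versions `Literature.Probability.Process.brownian` of the two coordinate processes). [folklore] -/
def pairPath (ω : WienerPair) : WienerPair :=
  (fun u => brownian u ω.1, fun u => brownian u ω.2)

/-- The **pair of shifted paths** at time `s`: `u ↦ (B_{s+u}(ω₁) - B_s(ω₁), B_{s+u}(ω₂) - B_s(ω₂))`.
[folklore] -/
def pairShift (s : ℝ≥0) (ω : WienerPair) : WienerPair :=
  (fun u => brownian (s + u) ω.1 - brownian s ω.1, fun u => brownian (s + u) ω.2 - brownian s ω.2)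

/-- The **pair of pasts** at time `s`: the two paths restricted to `[0, s]`. [folklore] -/
def pairPast (s : ℝ≥0) (ω : WienerPair) : (Iic s → ℝ) × (Iic s → ℝ) :=
  (fun u => brownian u ω.1, fun u => brownian u ω.2)

section API

variable (s : ℝ≥0)

/-- `pairPath` is `Prod.map` of the single path map. [folklore] -/
theorem pairPath_eq_prodMap :
    pairPath = Prod.map (fun (ω₁ : ℝ≥0 → ℝ) (u : ℝ≥0) => brownian u ω₁)
      fun (ω₂ : ℝ≥0 → ℝ) (u : ℝ≥0) => brownian u ω₂ := rfl

/-- `pairShift s` is `Prod.map` of the single shift map. [folklore] -/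
theorem pairShift_eq_prodMap :
    pairShift s = Prod.map (fun (ω₁ : ℝ≥0 → ℝ) (u : ℝ≥0) => brownian (s + u) ω₁ - brownian s ω₁)
      fun (ω₂ : ℝ≥0 → ℝ) (u : ℝ≥0) => brownian (s + u) ω₂ - brownian s ω₂ := rfl

/-- `pairPast s` is `Prod.map` of the single restriction map. [folklore] -/
theorem pairPast_eq_prodMap :
    pairPast s = Prod.map (fun (ω₁ : ℝ≥0 → ℝ) (u : Iic s) => brownian u ω₁)
      fun (ω₂ : ℝ≥0 → ℝ) (u : Iic s) => brownian u ω₂ := rfl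

/-- The single path map is measurable. [folklore] -/
theorem measurable_path : Measurable fun (ω₁ : ℝ≥0 → ℝ) (u : ℝ≥0) => brownian u ω₁ :=
  measurable_pi_lambda _ fun u => measurable_brownian u

/-- The single shift map is measurable. [folklore] -/
theorem measurable_shift :
    Measurable fun (ω₁ : ℝ≥0 → ℝ) (u : ℝ≥0) => brownian (s + u) ω₁ - brownian s ω₁ :=
  measurable_pi_lambda _ fun _ => (measurable_brownian _).sub (measurable_brownian _)

/-- The single restriction map is measurable. [folklore] -/
theorem measurable_past : Measurable fun (ω₁ : ℝ≥0 → ℝ) (u : Iic s) => brownian u ω₁ :=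
  measurable_pi_lambda _ fun _ => measurable_brownian _

/-- `pairPath` is measurable. [folklore] -/
@[fun_prop]
theorem measurable_pairPath : Measurable pairPath :=
  measurable_path.prodMap measurable_path

/-- `pairShift s` is measurable. [folklore] -/
@[fun_prop]
theorem measurable_pairShift : Measurable (pairShift s) :=
  (measurable_shift s).prodMap (measurable_shift s)

/-- `pairPast s` is measurable. [folklore] -/
@[fun_prop]
theorem measurable_pairPast : Measurable (pairPast s) :=
  (measurable_past s).prodMap (measurable_past s)

/-- The two paths of `pairPath ω` are continuous. [folklore] -/
theorem continuous_pairPath_fst (ω : WienerPair) : Continuous (pairPath ω).1 :=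
  continuous_brownian ω.1

/-- The two paths of `pairPath ω` are continuous. [folklore] -/
theorem continuous_pairPath_snd (ω : WienerPair) : Continuous (pairPath ω).2 :=
  continuous_brownian ω.2

/-- The two shifted paths are continuous. [folklore] -/
theorem continuous_pairShift_fst (ω : WienerPair) : Continuous (pairShift s ω).1 :=
  ((continuous_brownian ω.1).comp (continuous_const_add s)).sub continuous_const

/-- The two shifted paths are continuous. [folklore] -/
theorem continuous_pairShift_snd (ω : WienerPair) : Continuous (pairShift s ω).2 :=
  ((continuous_brownian ω.2).comp (continuous_const_add s)).sub continuous_const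

/-- The paths of `pairPath ω` start at `0`. [folklore] -/
@[simp] theorem pairPath_fst_zero (ω : WienerPair) : (pairPath ω).1 0 = 0 := by
  simp [pairPath]

/-- The paths of `pairPath ω` start at `0`. [folklore] -/
@[simp] theorem pairPath_snd_zero (ω : WienerPair) : (pairPath ω).2 0 = 0 := by
  simp [pairPath]

/-- The shifted paths start at `0`. [folklore] -/
@[simp] theorem pairShift_fst_zero (ω : WienerPair) : (pairShift s ω).1 0 = 0 := by
  simp [pairShift]

/-- The shifted paths start at `0`. [folklore] -/
@[simp] theorem pairShift_snd_zero (ω : WienerPair) : (pairShift s ω).2 0 = 0 := by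
  simp [pairShift]

/-- Unfolding `pairPath`. [folklore] -/
theorem pairPath_apply (ω : WienerPair) (u : ℝ≥0) :
    ((pairPath ω).1 u, (pairPath ω).2 u) = (brownian u ω.1, brownian u ω.2) := rfl

/-- Unfolding `pairShift`: the increments after `s`. [folklore] -/
theorem pairShift_apply (ω : WienerPair) (u : ℝ≥0) :
    ((pairShift s ω).1 u, (pairShift s ω).2 u) =
      (brownian (s + u) ω.1 - brownian s ω.1, brownian (s + u) ω.2 - brownian s ω.2) := rfl

/-- The past pair records the paths on `[0, s]`: `(pairPast s ω).1 u = B_u(ω₁)`. [folklore] -/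
@[simp] theorem pairPast_fst_apply (ω : WienerPair) (u : Iic s) :
    (pairPast s ω).1 u = brownian u ω.1 := rfl

/-- The past pair records the paths on `[0, s]`: `(pairPast s ω).2 u = B_u(ω₂)`. [folklore] -/
@[simp] theorem pairPast_snd_apply (ω : WienerPair) (u : Iic s) :
    (pairPast s ω).2 u = brownian u ω.2 := rfl

end API

/-! ### The weak Markov property of the pair at a deterministic time -/

/-- **The shifted pair is independent of the past pair** (simple Markov property of the pair of
independent Brownian motions at the deterministic time `s`): Mathlib's
`IsPreBrownianReal.indepFun_shift` in each coordinate, paired across the product measure.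
Revuz–Yor (1999), Ch. III §1–2; Kallenberg (2002), Thm 13.5 with Lemma 3.10. [folklore] -/
theorem indepFun_pairShift_pairPast (s : ℝ≥0) :
    IndepFun (pairShift s) (pairPast s) wienerPair := by
  haveI := RandomPlanarGeometry.isProbabilityMeasure_preWienerMeasure'
  have h1 : IndepFun (fun (ω₁ : ℝ≥0 → ℝ) (u : ℝ≥0) => brownian (s + u) ω₁ - brownian s ω₁)
      (fun (ω₁ : ℝ≥0 → ℝ) (u : Iic s) => brownian u ω₁) preWienerMeasure :=
    RandomPlanarGeometry.isPreBrownianReal_brownian.indepFun_shift s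
  rw [pairShift_eq_prodMap, pairPast_eq_prodMap, wienerPair]
  exact indepFun_prodMap h1 h1 (measurable_shift s) (measurable_past s) (measurable_shift s)
    (measurable_past s)

/-- **The law of the single shifted path is the law of the single path** (both are pre-Brownian
motions with measurable marginals). Revuz–Yor (1999), Ch. I; Mathlib `IsPreBrownianReal.shift`.
[folklore] -/
theorem map_shift_eq_map_path (s : ℝ≥0) :
    preWienerMeasure.map (fun (ω₁ : ℝ≥0 → ℝ) (u : ℝ≥0) => brownian (s + u) ω₁ - brownian s ω₁) =
      preWienerMeasure.map fun (ω₁ : ℝ≥0 → ℝ) (u : ℝ≥0) => brownian u ω₁ :=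
  IsPreBrownianReal.map_path_eq (RandomPlanarGeometry.isPreBrownianReal_brownian.shift s) RandomPlanarGeometry.isPreBrownianReal_brownian
    (fun _ => (measurable_brownian _).sub (measurable_brownian _)) measurable_brownian

/-- **The law of the single continuous path is the pre-Wiener measure itself** (the continuous
version `brownian` and the coordinate process are both pre-Brownian). [folklore] -/
theorem map_path_preWienerMeasure :
    preWienerMeasure.map (fun (ω₁ : ℝ≥0 → ℝ) (u : ℝ≥0) => brownian u ω₁) = preWienerMeasure := by
  have h := IsPreBrownianReal.map_path_eq RandomPlanarGeometry.isPreBrownianReal_brownian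
    (isPreBrownianReal_eval RandomPlanarGeometry.isProjectiveLimit_preWienerMeasure_holds) measurable_brownian
    (fun t => measurable_pi_apply t)
  rw [h]
  exact Measure.map_id

/-- **The shifted pair has the law of the pair of paths.** [folklore] -/
theorem map_pairShift_eq_map_pairPath (s : ℝ≥0) :
    wienerPair.map (pairShift s) = wienerPair.map pairPath := by
  haveI := RandomPlanarGeometry.isProbabilityMeasure_preWienerMeasure'
  rw [pairShift_eq_prodMap, pairPath_eq_prodMap, wienerPair,
    ← Measure.map_prod_map _ _ (measurable_shift s) (measurable_shift s),
    ← Measure.map_prod_map _ _ measurable_path measurable_path, map_shift_eq_map_path]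

/-- **The pair of continuous paths has law `wienerPair`.** [folklore] -/
theorem map_pairPath_wienerPair : wienerPair.map pairPath = wienerPair := by
  haveI := RandomPlanarGeometry.isProbabilityMeasure_preWienerMeasure'
  rw [pairPath_eq_prodMap, wienerPair, ← Measure.map_prod_map _ _ measurable_path measurable_path,
    map_path_preWienerMeasure]

/-- The shifted pair has law `wienerPair`. [folklore] -/
theorem map_pairShift_wienerPair (s : ℝ≥0) : wienerPair.map (pairShift s) = wienerPair := by
  rw [map_pairShift_eq_map_pairPath, map_pairPath_wienerPair]

/-- **Markov factorisation of expectations.** For a nonnegative jointly measurable `G`, a random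
variable `ξ` measurable with respect to the past of the pair at time `s`, and the shifted pair
`η = pairShift s`: `E[G(ξ, η)] = E[ ω ↦ ∫ G(ξ ω, pairPath ω') dP(ω') ]` — independence of `η`
from the past and `law(η) = law(pairPath)`. This is the form of the simple Markov property used to
prove the Chapman–Kolmogorov equation for SDEs driven by the pair. [folklore] -/
theorem lintegral_comp_pairShift_eq {X : Type*} [MeasurableSpace X] (s : ℝ≥0) {ξ : WienerPair → X}
    (hξ : Measurable[MeasurableSpace.comap (pairPast s) inferInstance] ξ)
    {G : X × WienerPair → ℝ≥0∞} (hG : Measurable G) :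
    ∫⁻ ω, G (ξ ω, pairShift s ω) ∂wienerPair =
      ∫⁻ ω, ∫⁻ ω', G (ξ ω, pairPath ω') ∂wienerPair ∂wienerPair := by
  have hξm : Measurable ξ := hξ.mono (measurable_pairPast s).comap_le le_rfl
  -- `η ⟂ ξ` since `σ(ξ) ≤ σ(past)`
  have hind : IndepFun ξ (pairShift s) wienerPair := by
    have h := indepFun_pairShift_pairPast s
    rw [IndepFun_iff_Indep] at h ⊢
    exact (indep_of_indep_of_le_right h (measurable_iff_comap_le.1 hξ)).symm
  have hlaw : wienerPair.map (fun ω => (ξ ω, pairShift s ω)) =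
      (wienerPair.map ξ).prod (wienerPair.map (pairShift s)) :=
    (indepFun_iff_map_prod_eq_prod_map_map hξm.aemeasurable
      (measurable_pairShift s).aemeasurable).1 hind
  calc ∫⁻ ω, G (ξ ω, pairShift s ω) ∂wienerPair
      = ∫⁻ p, G p ∂(wienerPair.map fun ω => (ξ ω, pairShift s ω)) := by
        rw [lintegral_map hG (hξm.prodMk (measurable_pairShift s))]
    _ = ∫⁻ p, G p ∂((wienerPair.map ξ).prod (wienerPair.map (pairShift s))) := by rw [hlaw]
    _ = ∫⁻ x, ∫⁻ w, G (x, w) ∂(wienerPair.map (pairShift s)) ∂(wienerPair.map ξ) :=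
        lintegral_prod _ hG.aemeasurable
    _ = ∫⁻ x, ∫⁻ w, G (x, w) ∂(wienerPair.map pairPath) ∂(wienerPair.map ξ) := by
        rw [map_pairShift_eq_map_pairPath]
    _ = ∫⁻ x, ∫⁻ ω', G (x, pairPath ω') ∂wienerPair ∂(wienerPair.map ξ) := by
        congr 1
        funext x
        have hGx : Measurable fun w => G (x, w) := hG.comp (measurable_const.prodMk measurable_id)
        rw [lintegral_map hGx measurable_pairPath]
    _ = ∫⁻ ω, ∫⁻ ω', G (ξ ω, pairPath ω') ∂wienerPair ∂wienerPair := by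
        have hF : Measurable fun x => ∫⁻ ω', G (x, pairPath ω') ∂wienerPair :=
          (hG.comp (measurable_fst.prodMk (measurable_pairPath.comp measurable_snd))).lintegral_prod_right'
        rw [lintegral_map hF hξm]

end Literature.Probability.Process
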